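import Literature.NumberTheory.EllipticCurves.IwasawaEulerCharDualityProofs
import HarnessLib

/-!
# Pontryagin duality for TWO-GENERATOR ideals on a dual pair: `#(X ⧸ (m, g)X) = #{s ∈ S | m s = 0, φ s = 0}`
# — in particular `#(X ⧸ (p^k, ω_n)X) = #(S[p^k])^{γ^{p^n}}` (crux ♭T′ stmt-BirchSwinnertonDyer-26975, line
# `sigmacongruence`, input (1b′) of the growth road to stub TS1)

Route `UniversalToricDescent`, lead prover `bsd-wall-utd-p1` g15. THEOREMS ONLY (no definition, no named fact, no `sorry`);
`--supports stmt-BirchSwinnertonDyer-26975`. BSD is not proved by any of this.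

For an axiomatic Pontryagin dual pair (`IwasawaDual.IsDualPair p ψ toDual`: `toDual : X ≃ Hom(S, ℚ/ℤ)`, `T` acts as `ψ`) —
the tree's `Castella2018.AcSelmer.XAc.isDualPair` makes `X = X_ac^Σ`, `S = Sel_𝔭^Σ(K_∞, E[p^∞])`, `ψ = conj_γ − 1` one —
and an element `g ∈ Λ` acting under the duality as an endomorphism `φ` of `S` (`toDual (g x) s = toDual x (φ s)`; e.g.
`g = (1+T)^{p^n} − 1`, `φ = conj_γ^{p^n} − 1`: `eval_omega_smul`):

* `exists_eq_add_of_forall_eval_eq_zero` — a character `toDual x` killing `S[m] ∩ ker φ` is `toDual (m x₁ + g x₂)`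
  (the character factors through `s ↦ (m s, φ s)` and extends to `S × S`, `ℚ/ℤ` being injective; the two-generator form of
  the tree's `mem_mPow_one_of_mem_annPiece`);
* `natCard_quotient_span_pair_smul` — **`#(X ⧸ (m, g)•X) = #{s | m s = 0 ∧ φ s = 0}`** (`X/(m,g)X ≅ Hom(S[m] ∩ ker φ, ℚ/ℤ)`
  and `#Hom(A, ℚ/ℤ) = #A`, `PontryaginCard.natCard_eq_of_addEquiv_characterModule`); both sides `0` when infinite;
* `natCard_quotient_span_pow_omega_smul` — the case `(p^k, (1+T)^{p^n} − 1)`: `#(X ⧸ (p^k, ω_n)X) = #{s | p^k s = 0 ∧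
  (1+ψ)^{p^n} s = s}` — the left side of the weak-Leopoldt growth hypothesis of `injective_of_weakLeopoldt_growth` (p645087) as the
  order of the `p^k`-torsion of the `Γ_n`-invariants of the discrete side.

References: [GreenbergLNM1716] §1 p. 60 (`X/𝔪X` finite ⟺ `Sel_∞[𝔪]` finite); [Washington1997] §13.2.
-/

set_option autoImplicit false
-- the Theorems namespace of this sub repeats the summit name by design (D-0017 nested layout)
set_option linter.dupNamespace false

noncomputable section

open scoped Classical
open Literature.NumberTheory.EllipticCurves Literature.NumberTheory.EllipticCurves.IwasawaDual

namespace Summit.BirchSwinnertonDyer.BirchSwinnertonDyer.Theorems.UniversalToricDescentDualPairIdealCount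

universe u

variable {p : ℕ} [Fact p.Prime]
variable {S : Type*} [AddCommGroup S] {ψ : AddMonoid.End S}
variable {X : Type u} [AddCommGroup X] [Module (PowerSeries ℤ_[p]) X]
variable {toDual : X →+ (S →+ AddCircle (1 : ℚ))}

/-- **A character killing `S[m] ∩ ker φ` is `toDual (m x₁ + g x₂)`** when `g ∈ Λ` acts as `φ` under the duality: it factors
through the image of `δ : s ↦ (m s, φ s)` and extends to `S × S` (`ℚ/ℤ` injective). [cite: GreenbergLNM1716, §1 p. 60] -/
theorem exists_eq_add_of_forall_eval_eq_zero (h : IsDualPair p ψ toDual) (m : ℕ)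
    {g : PowerSeries ℤ_[p]} {φ : AddMonoid.End S} (hg : ∀ (x : X) (s : S), toDual (g • x) s = toDual x (φ s))
    {x : X} (hx : ∀ s : S, m • s = 0 → φ s = 0 → toDual x s = 0) :
    ∃ x₁ x₂ : X, x = m • x₁ + g • x₂ := by
  let δ : S →+ S × S := (DistribSMul.toAddMonoidHom S m).prod φ
  have hδ : ∀ s, δ s = (m • s, φ s) := fun s ↦ rfl
  have hker : δ.rangeRestrict.ker ≤ (toDual x).ker := by
    intro s hs
    rw [AddMonoidHom.mem_ker] at hs ⊢
    have hs' : δ s = 0 := congrArg (fun z : δ.range ↦ (z : S × S)) hs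
    rw [hδ, Prod.mk_eq_zero] at hs'
    exact hx s hs'.1 hs'.2
  have hsurj : Function.Surjective δ.rangeRestrict := AddMonoidHom.rangeRestrict_surjective δ
  let χ' : δ.range →+ AddCircle (1 : ℚ) := δ.rangeRestrict.liftOfSurjective hsurj ⟨toDual x, hker⟩
  have hχ' : ∀ s, χ' (δ.rangeRestrict s) = toDual x s := fun s ↦
    AddMonoidHom.liftOfRightInverse_comp_apply _ _ _ _ s
  obtain ⟨y, hy⟩ := CharacterModule.dual_surjective_of_injective
    (δ.range.subtype.toIntLinearMap) (fun a b hab ↦ Subtype.ext hab) χ'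
  have hy' : ∀ z : δ.range, y z = χ' z := fun z ↦ by
    have := DFunLike.congr_fun hy z
    rw [CharacterModule.dual_apply] at this
    exact this
  let y₀ : S × S →+ AddCircle (1 : ℚ) := y
  let y₁ : S →+ AddCircle (1 : ℚ) := y₀.comp (AddMonoidHom.inl S S)
  let y₂ : S →+ AddCircle (1 : ℚ) := y₀.comp (AddMonoidHom.inr S S)
  have hsplit : ∀ s, toDual x s = y₁ (m • s) + y₂ (φ s) := by
    intro s
    have e1 : toDual x s = y₀ ((δ.rangeRestrict s : δ.range) : S × S) := by
      rw [← hχ' s, ← hy']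
      rfl
    rw [e1]
    change y₀ (δ s) = y₀ (m • s, 0) + y₀ (0, φ s)
    rw [← map_add, Prod.mk_add_mk, add_zero, zero_add, hδ]
  obtain ⟨x₁, hx₁⟩ := h.bijective.2 y₁
  obtain ⟨x₂, hx₂⟩ := h.bijective.2 y₂
  refine ⟨x₁, x₂, h.bijective.1 ?_⟩
  ext s
  rw [map_add, AddMonoidHom.add_apply, nsmul_eval, hg, hx₁, hx₂, hsplit]

/-- Membership in `(a, b)•X`: `x = a x₁ + b x₂`. [folklore] -/
theorem mem_span_pair_smul_top_iff (a b : PowerSeries ℤ_[p]) (x : X) :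
    x ∈ (Ideal.span {a, b} • ⊤ : Submodule (PowerSeries ℤ_[p]) X) ↔ ∃ x₁ x₂ : X, x = a • x₁ + b • x₂ := by
  rw [Ideal.span_insert, Submodule.sup_smul, Submodule.ideal_span_singleton_smul,
    Submodule.ideal_span_singleton_smul, Submodule.mem_sup]
  constructor
  · rintro ⟨y, hy, z, hz, rfl⟩
    obtain ⟨x₁, -, rfl⟩ := (Submodule.mem_smul_pointwise_iff_exists y a ⊤).mp hy
    obtain ⟨x₂, -, rfl⟩ := (Submodule.mem_smul_pointwise_iff_exists z b ⊤).mp hz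
    exact ⟨x₁, x₂, rfl⟩
  · rintro ⟨x₁, x₂, rfl⟩
    exact ⟨a • x₁, Submodule.smul_mem_pointwise_smul _ _ _ Submodule.mem_top,
      b • x₂, Submodule.smul_mem_pointwise_smul _ _ _ Submodule.mem_top, rfl⟩

/-- **`#(X ⧸ (m, g)•X) = #{s | m s = 0 ∧ φ s = 0}`** for a dual pair and `g` acting as `φ`: the quotient is the character group of
`S[m] ∩ ker φ` (restriction of characters; kernel `(m, g)•X` by `exists_eq_add_of_forall_eval_eq_zero`; onto since `ℚ/ℤ` is
injective), and `#Hom(A, ℚ/ℤ) = #A`. [cite: GreenbergLNM1716, §1 p. 60] -/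
theorem natCard_quotient_span_pair_smul (h : IsDualPair p ψ toDual) (m : ℕ)
    {g : PowerSeries ℤ_[p]} {φ : AddMonoid.End S} (hg : ∀ (x : X) (s : S), toDual (g • x) s = toDual x (φ s)) :
    Nat.card (X ⧸ (Ideal.span {((m : ℕ) : PowerSeries ℤ_[p]), g} • ⊤ : Submodule (PowerSeries ℤ_[p]) X)) =
      Nat.card ((DistribSMul.toAddMonoidHom S m).ker ⊓ φ.ker : AddSubgroup S) := by
  set A : AddSubgroup S := (DistribSMul.toAddMonoidHom S m).ker ⊓ φ.ker
  set N : Submodule (PowerSeries ℤ_[p]) X := Ideal.span {((m : ℕ) : PowerSeries ℤ_[p]), g} • ⊤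
  have hA : ∀ s : S, s ∈ A ↔ m • s = 0 ∧ φ s = 0 := fun s ↦ by
    simp only [A, AddSubgroup.mem_inf, AddMonoidHom.mem_ker]
    rfl
  -- restriction of characters `R₀ : X → Hom(A, ℚ/ℤ)`
  let R₀ : X →+ CharacterModule A :=
    { toFun := fun x ↦ (toDual x).comp A.subtype
      map_zero' := by rw [map_zero, AddMonoidHom.zero_comp]; rfl
      map_add' := fun x y ↦ by rw [map_add, AddMonoidHom.add_comp]; rfl }
  have hR₀ : ∀ (x : X) (a : A), R₀ x a = toDual x a := fun _ _ ↦ rfl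
  have hR₀N : ∀ x ∈ N, R₀ x = 0 := by
    intro x hx
    obtain ⟨x₁, x₂, rfl⟩ := (mem_span_pair_smul_top_iff _ _ x).mp hx
    refine CharacterModule.ext (A := A) fun a ↦ ?_
    have ha := (hA a).mp a.2
    rw [hR₀, map_add, AddMonoidHom.add_apply, Nat.cast_smul_eq_nsmul, nsmul_eval, hg, ha.1, ha.2, map_zero,
      map_zero, add_zero, characterModule_zero_apply]
  let R : (X ⧸ N) →+ CharacterModule A :=
    QuotientAddGroup.lift N.toAddSubgroup R₀ (fun x hx ↦ hR₀N x hx)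
  have hRmk : ∀ x : X, R (Submodule.Quotient.mk x) = R₀ x := fun _ ↦ rfl
  have hRbij : Function.Bijective R := by
    constructor
    · rw [injective_iff_map_eq_zero]
      intro q hq
      induction q using Submodule.Quotient.induction_on with
      | H x =>
        rw [hRmk] at hq
        have hx : ∀ s : S, m • s = 0 → φ s = 0 → toDual x s = 0 := fun s hs1 hs2 ↦ by
          have := DFunLike.congr_fun hq ⟨s, (hA s).mpr ⟨hs1, hs2⟩⟩
          rwa [hR₀] at this
        obtain ⟨x₁, x₂, rfl⟩ := exists_eq_add_of_forall_eval_eq_zero h m hg hx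
        exact (Submodule.Quotient.mk_eq_zero N).mpr
          ((mem_span_pair_smul_top_iff _ _ _).mpr ⟨x₁, x₂, by rw [Nat.cast_smul_eq_nsmul]⟩)
    · intro χ
      obtain ⟨χ', hχ'⟩ := CharacterModule.dual_surjective_of_injective
        A.subtype.toIntLinearMap (fun a b hab ↦ Subtype.ext hab) χ
      obtain ⟨x, hx⟩ := h.bijective.2 χ'
      refine ⟨Submodule.Quotient.mk x, ?_⟩
      rw [hRmk]
      refine CharacterModule.ext (A := A) fun a ↦ ?_
      rw [hR₀, hx, ← hχ']
      rfl
  exact PontryaginCard.natCard_eq_of_addEquiv_characterModule (AddEquiv.ofBijective R hRbij)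

/-- **`(1+T)^j` acts as `(1+ψ)^j`**: `toDual ((1+T)^j x) s = toDual x ((1+ψ)^j s)` — for `ψ = conj_γ − 1` this is `conj_{γ^j}`.
[folklore] -/
theorem eval_one_add_X_pow_smul (h : IsDualPair p ψ toDual) (j : ℕ) (x : X) (s : S) :
    toDual (((1 : PowerSeries ℤ_[p]) + PowerSeries.X) ^ j • x) s = toDual x (((1 + ψ) ^ j) s) := by
  induction j generalizing s with
  | zero => simp
  | succ j ih =>
    rw [pow_succ', mul_smul, add_smul, one_smul, map_add, AddMonoidHom.add_apply, h.T_smul, ih, ih, pow_succ,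
      AddMonoid.End.coe_mul, Function.comp_apply, ← map_add]
    congr 1
    rw [← map_add]
    congr 1

/-- **`ω_n = (1+T)^{p^n} − 1` acts as `(1+ψ)^{p^n} − 1`.** [folklore] -/
theorem eval_omega_smul (h : IsDualPair p ψ toDual) (n : ℕ) (x : X) (s : S) :
    toDual ((((1 : PowerSeries ℤ_[p]) + PowerSeries.X) ^ (p ^ n) - 1) • x) s =
      toDual x (((1 + ψ) ^ (p ^ n) - 1) s) := by
  rw [sub_smul, one_smul, map_sub, AddMonoidHom.sub_apply, eval_one_add_X_pow_smul h, IwasawaDual.End_sub_apply,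
    AddMonoid.End.one_apply, map_sub]

/-- **`#(X ⧸ (p^k, ω_n)X) = #{s | p^k s = 0 ∧ (1+ψ)^{p^n} s = s}`** — the growth quantity of
`injective_of_weakLeopoldt_growth` (p645087) read on the discrete side: the `p^k`-torsion of the `Γ_n`-invariants
(`(1+ψ)^{p^n} = conj_{γ^{p^n}}` for `ψ = conj_γ − 1`). [cite: GreenbergLNM1716, §1 p. 60] [cite: Washington1997, §13.2] -/
theorem natCard_quotient_span_pow_omega_smul (h : IsDualPair p ψ toDual) (n k : ℕ) :
    Nat.card (X ⧸ (Ideal.span {((p ^ k : ℕ) : PowerSeries ℤ_[p]),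
        ((1 : PowerSeries ℤ_[p]) + PowerSeries.X) ^ (p ^ n) - 1} • ⊤ : Submodule (PowerSeries ℤ_[p]) X)) =
      Nat.card ((DistribSMul.toAddMonoidHom S (p ^ k)).ker ⊓ ((1 + ψ) ^ (p ^ n) - 1).ker : AddSubgroup S) :=
  natCard_quotient_span_pair_smul h (p ^ k) (eval_omega_smul h n)

end Summit.BirchSwinnertonDyer.BirchSwinnertonDyer.Theorems.UniversalToricDescentDualPairIdealCount

end
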